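import Literature.MathematicalPhysics.QuantumFieldTheory.Balaban1983to89.B13AccretiveOfRealCoercive
import Literature.MathematicalPhysics.QuantumFieldTheory.Balaban1983to89.B9Eq386Neumann

/-!
# `Balaban1983to89.B13InverseLettersNeumann` — T. Bałaban, *Propagators for lattice gauge theories in a background field*, Commun. Math. Phys.
**99** (1985) 389–434 [Balaban1985BackgroundPropagators], Sect. B p. 402: «We assume that Theorem 3.1 is valid for the operator G′(U). The equality
(3.60) can be written as Δ′(U′U) = (I − V′(A)G′(U))Δ′(U) (3.62) … for α₁ sufficiently small the norm of this operator is small and I − V′(A)G′(U) is an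
invertible operator, the inverse is given by a convergent Neumann series. This implies the existence of the operator G′(U′U) and the equality
G′(U′U) = G′(U)(I − V′(A)G′(U))⁻¹ = Σₙ G′(U)(V′(A)G′(U))ⁿ (3.64)» and p. 403 ll. 3–5: «Now applying Theorem 3.1 for G′(U), the bound (3.63), the representation
(3.64) and Lemma 2.1 of [4] we can prove all the statements (3.42)–(3.47) of Theorem 3.1 for the operator G′(U′U), of course with different constants»;
(3.86) p. 407 (the same for `G(U′U)`); Thm 3.4 p. 400; Thm 3.10 (3.107)–(3.108)
p. 416; *Renormalization group approach to lattice gauge field theories. II*, Commun. Math. Phys. **116** (1988) 1–22 [Balaban1988RG2Cluster] p. 13, p. 15: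
SECT. B's ROAD IN ENTRY-LETTER CURRENCY — the (3.108)-letters (entrywise exponential decay + holomorphy) of an INVERSE family `u ↦ A(u)⁻¹` on a THIN
complex ball from (i) the letters of the UN-inverted family `A` on the big ball (the complexified operator — [II] p. 15's in-edge), (ii) ONE right inverse
`G₀` of `A(0)` with (3.108)-letters (Theorem 3.10 AT THE CENTRE: one real background), by the NEUMANN SERIES `A(u)⁻¹ = G₀·Σₙ((A(0) − A(u))G₀)ⁿ` — the
deviation `A(0) − A(u)` being small with decay by the SCHWARZ LEMMA (module 56A), the series resummed entrywise with [4]'s row sums (module 34's letter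
algebra), the ring identities being pv27's kernel certificate `B9Eq386Neumann` of (3.86) read on the matrix ring with the sup-of-row-sums norm
(Mathlib `Matrix.Norms.Operator`).  NO real structure, NO two-constants theorem (no rate loss `λ`, no `R_an > 2R₀`), NO accretivity margin and NO lower
bound are used — a third road beside `B13RealSliceEntryLetters` §3 (two constants) and `B13AccretiveOfRealCoercive` §4 (perturbative margin).

statement-level bookkeeping ([folklore] Neumann series, Schwarz lemma) over Mathlib and the landed `B9Eq386Neumann` ∕ `B13EntryLetterAlgebra` ∕
`B13AccretiveOfRealCoercive` theorems, with citation tags; kernel-checked; nothing here is a claim about the Yang–Mills mass gap; nothing of Bałaban's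
operators is constructed or asserted; no node is discharged; count-neutral.

WHY THIS FILE (cell `pub-ymgap`, HUMAN RULING D-0062, Track A node N10 = [B13]; seat `pub-ymgap-dag-n10-c` g12, module 58; census
`N10-RESIDUAL-CENSUS-v13.md`).  The N10 junction's NODE-A input for an INVERSE piece of Bałaban's operator (`G = Δ_a⁻¹`, `G′`, `(Q′G′²Q′\*)⁻¹` inside
`Δ_k`) is an entrywise letter datum `RawEntryLetters` on a complex configuration ball (junction form `…WalksBlockEntrywise`, binder `hEL`).  The two landed
roads to it display, besides Theorem 3.10 at real backgrounds, a REAL STRUCTURE + a real FAMILY of backgrounds + holomorphy on a ball of MORE THAN TWICE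
the radius + either an accretivity margin (38 §3) or a real lower bound (56A §4).  Print's own road (Sect. B) needs less: Theorem 3.10 at ONE real background
and the smallness of the holomorphic deviation.  THIS FILE types that road:
* §1 matrix-norm trivia under `Matrix.Norms.Operator` (‖·‖ = sup of absolute row sums): `linfty_opNorm_le_of_rowSum`, `hasSum_apply_of_hasSum`
  (entrywise sums from a norm-convergent matrix series — the norm's uniformity is the product one).
* §2 ★ `rawEntryLetters_zero_sub` — the DEVIATION family `u ↦ A(0) − A(u)` has letters `(R₁, ρ, 2B·R₁∕R)` on the thin ball `R₁ ≤ R` (56A §1 Schwarz with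
  the decaying majorant): print's «for α₁ sufficiently small the norm of this operator is small», from holomorphy alone.
* §3 ★★★ `rawEntryLetters_inv_of_neumann` — from `RawEntryLetters A loc R ρ B`, a right inverse `G₀` of `A 0` with `‖G₀ i j‖ ≤ B_G e^{−ρ d(loc i, loc j)}`,
  a fibre bound `m` of `loc`, a row sum `C` at a rate `μ ≥ 0` with `3μ ≤ ρ`, the thin radius `0 < R₁ ≤ R` and the smallness `(2B·R₁∕R)·B_G·(mC)² ≤ ½`:
  `RawEntryLetters (u ↦ A(u)⁻¹) loc R₁ (ρ − 3μ) (2B_G)` (rate lost thrice: deviation × `G₀`, powers, `G₀` × powers; constant = `B_G·Σ(½)ⁿ`);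
  `rawEntryLetters_inv_of_neumann_torus` (`C = c₀(1,μ)^ν`, `μ > 0`, every torus size).
* §4 A2 ∕ A6 at module 38's toy family over `E = ℂ` (`A(u) = (γ+u)·1`, `G₀ = γ⁻¹·1`): `rawEntryLetters_toyFamily`, `toy_rightInverse`, `toy_G₀_letters`,
  ★ `rawEntryLetters_inv_of_neumann_toy` — every §3 binder jointly inhabited with genuine `u`-dependence.
HONEST FRAMING: generic kernel bookkeeping; Theorem 3.10 at the centre and the complexification of Bałaban's operators stay displayed hypotheses of their
owners (N06 ∕ NODE 00); nothing of Bałaban's is constructed or asserted; N10 NOT discharged; count-neutral; 0 `def`, 0 `sorry`; standard axioms; nothing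
continuum ∕ OS ∕ mass gap ∕ Clay.

References: T. Bałaban, CMP 99 (1985) 389–434 [Balaban1985BackgroundPropagators] (3.26)–(3.27) p.395, Thm 3.4 p.400, Sect. B (3.60)–(3.65) p.402, (3.86)
p.407, Thm 3.10 (3.107)–(3.108) pp.415–416; CMP 116 (1988) 1–22 [Balaban1988RG2Cluster] (2.5)–(2.7) pp.12–13, p.15, (2.16) p.16; CMP 109 (1987) 249–301
[Balaban1987RG1] (1.13)–(1.14) p.262, p.263; CMP 96 (1984) 223–250 [Balaban1984PropagatorsII] (2.52)–(2.55) p.232, Lemma 2.1 (2.61) p.234.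
────────────────────────────────────────────────────────────────────────────────────────────────────────────────
v1.0.1 (docstring-only; declarations byte-identical): the closing sentence of the Sect.-B quotation is p. 403 ll. 3–5 (not p. 402) and is now quoted
verbatim («the bound (3.63), the representation (3.64)»; referee ref-B g23 READ-742 NIT-L1 on the sibling 58B; print checked first-hand).
-/

noncomputable section

namespace Literature.MathematicalPhysics.QuantumFieldTheory.Balaban1983to89.B13InverseLettersNeumann

open Metric Set Finset
open scoped Matrix
open Literature.MathematicalPhysics.QuantumFieldTheory.Balaban1983to89
open Literature.MathematicalPhysics.QuantumFieldTheory.Balaban1983to89.B9Thm37GlueTorus (tdist1 tdist1_nonneg tdist1_comm tdist1_self)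
open Literature.MathematicalPhysics.QuantumFieldTheory.Balaban1983to89.B5TorusCover (UT)
open Literature.MathematicalPhysics.QuantumFieldTheory.Balaban1983to89.B13EntrywiseWalks (RawEntryLetters)
open Literature.MathematicalPhysics.QuantumFieldTheory.Balaban1983to89.B13Sqrt27Accretive (differentiableOn_inv_apply)
open Literature.MathematicalPhysics.QuantumFieldTheory.Balaban1983to89.B13EntryLetterAlgebra
  (rawEntryLetters_const rawEntryLetters_mul rawEntryLetters_pow rawEntryLetters_mono)
open Literature.MathematicalPhysics.QuantumFieldTheory.Balaban1983to89.B13LocalKernelWalks (rowSum_torus)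
open Literature.MathematicalPhysics.QuantumFieldTheory.Balaban1983to89.B13AccretiveOfRealCoercive (norm_entry_sub_zero_le rowSum_decay_le)
open Literature.MathematicalPhysics.QuantumFieldTheory.Balaban1983to89.B13RealSliceEntryLetters (realStructureComplex toyFamily toy_holo)
open Literature.MathematicalPhysics.QuantumFieldTheory.Balaban1983to89.B9Eq386Neumann (gNew sub_mul_gNew hasSum_gNew)

variable {ν : ℕ} {Nf : Fin ν → ℕ} [∀ i, NeZero (Nf i)]
variable {E : Type*} [NormedAddCommGroup E] [NormedSpace ℂ E]
variable {p : Type} [Fintype p] [DecidableEq p]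

/-! ## §1. Matrix-norm trivia (sup of absolute row sums) -/

section Norms

open scoped Matrix.Norms.Operator

/-- The sup-of-row-sums norm is at most any common bound of the absolute row sums. [folklore] [cite: Balaban1984PropagatorsII, Lemma 2.1 (2.61) p.234] -/
theorem linfty_opNorm_le_of_rowSum (K : Matrix p p ℂ) {s : ℝ} (hs : 0 ≤ s) (h : ∀ i, ∑ j, ‖K i j‖ ≤ s) : ‖K‖ ≤ s := by
  rw [Matrix.linfty_opNorm_def]
  have key : ∀ i, (∑ j, ‖K i j‖₊ : NNReal) ≤ s.toNNReal := fun i => by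
    rw [← NNReal.coe_le_coe, NNReal.coe_sum, Real.coe_toNNReal _ hs]
    simpa using h i
  have hsup : (Finset.univ.sup fun i => ∑ j, ‖K i j‖₊) ≤ s.toNNReal := Finset.sup_le fun i _ => key i
  exact (NNReal.coe_le_coe.2 hsup).trans_eq (Real.coe_toNNReal _ hs)

omit [Fintype p] [DecidableEq p] in
/-- Entrywise sums from a norm-convergent matrix series (the norm's uniformity is the product uniformity). [folklore]
[cite: Balaban1985BackgroundPropagators, (3.86) p.407] -/
theorem hasSum_apply_of_hasSum {f : ℕ → Matrix p p ℂ} {S : Matrix p p ℂ} (h : HasSum f S) (i j : p) :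
    HasSum (fun n => f n i j) (S i j) :=
  (Pi.hasSum.mp (Pi.hasSum.mp h i)) j

end Norms

/-! ## §2. The deviation family has small decaying letters on the thin ball (Schwarz) -/

section Deviation

variable {A : E → Matrix p p ℂ} {loc : p → UT Nf} {R R₁ ρ B : ℝ}

omit [Fintype p] [DecidableEq p] in
/-- ★ **THE DEVIATION `u ↦ A(0) − A(u)` HAS LETTERS `(R₁, ρ, 2B·R₁∕R)`** on the thin ball `‖u‖ < R₁ ≤ R`, from the letters `(R, ρ, B)` of `A`:
the Schwarz lemma entry by entry with the decaying majorant `B·e^{−ρd}` (module 56A `norm_entry_sub_zero_le`) — print's «V′(A) … satisfies the bound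
(3.61) … for α₁ sufficiently small the norm of this operator is small» (p. 402), here from HOLOMORPHY alone.
[cite: Balaban1985BackgroundPropagators, (3.60)-(3.63) p.402, Thm 3.4 p.400; Balaban1988RG2Cluster, p.15] -/
theorem rawEntryLetters_zero_sub (hA : RawEntryLetters A loc R ρ B) (hR₁ : 0 ≤ R₁) (hR₁R : R₁ ≤ R) :
    RawEntryLetters (fun u => A 0 - A u) loc R₁ ρ (2 * B * R₁ / R) where
  decay u hu i j := by
    have h := norm_entry_sub_zero_le hA.holo hA.decay hR₁R u hu i j
    rw [Matrix.sub_apply, norm_sub_rev]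
    calc ‖A u i j - A 0 i j‖ ≤ 2 * (B * Real.exp (-(ρ * tdist1 Nf (loc i) (loc j)))) * R₁ / R := h
      _ = 2 * B * R₁ / R * Real.exp (-(ρ * tdist1 Nf (loc i) (loc j))) := by ring
  holo i j := by
    have h : DifferentiableOn ℂ (fun u => A 0 i j - A u i j) (ball (0 : E) R₁) :=
      (differentiableOn_const _).sub ((hA.holo i j).mono (ball_subset_ball hR₁R))
    exact h.congr fun u _ => by rw [Matrix.sub_apply]
  B_nonneg := div_nonneg (mul_nonneg (mul_nonneg (by norm_num) hA.B_nonneg) hR₁) (hR₁.trans hR₁R)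

end Deviation

/-! ## §3. ★★★ The (3.108)-letters of the inverse family on the thin ball by the Neumann series (3.62)–(3.64) ∕ (3.86) -/

section Neumann

open scoped Matrix.Norms.Operator

variable {A : E → Matrix p p ℂ} {loc : p → UT Nf} {R R₁ ρ μ B BG C : ℝ} {m : ℕ} {G₀ : Matrix p p ℂ}

/-- ★★★ **SECT. B's ROAD: LETTERS OF `u ↦ A(u)⁻¹` ON THE THIN BALL FROM THE LETTERS AT THE CENTRE.**  Inputs: (i) `RawEntryLetters A loc R ρ B` — the
complexified operator on the chart ball `‖u‖ < R` ([II] p. 15 ∕ [I] p. 263: displayed by its owner); (ii) ONE right inverse `G₀` of `A(0)` with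
`‖G₀ i j‖ ≤ B_G e^{−ρ d(loc i, loc j)}` — Theorem 3.10's (3.108) for `G(U₀) = Δ_a(U₀)⁻¹` AT THE CENTRE `U₀` (one real background; N06's content);
(iii) a fibre bound `m` of the location map and a row sum `C` of the torus at a rate `μ ≥ 0` with `3μ ≤ ρ` ([4] (2.61)); (iv) the THIN RADIUS `0 < R₁ ≤ R`
with the smallness `(2B·R₁∕R)·B_G·(mC)² ≤ ½` (print's «α₁ sufficiently small»).  Conclusion: `RawEntryLetters (u ↦ A(u)⁻¹) loc R₁ (ρ − 3μ) (2B_G)`.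
Proof = print's: `A(u) = A(0) − V(u)`; `V(u)G₀` has letters `(R₁, ρ−μ, θ)`, `θ = (2BR₁∕R)·B_G·(mC)` (§2 × `G₀`, module 34 `rawEntryLetters_mul`), hence
sup-row-sum norm `≤ θ·(mC) ≤ ½`; so `A(u)⁻¹ = G₀·Σₙ(V(u)G₀)ⁿ` (`B9Eq386Neumann.sub_mul_gNew` on the matrix ring, `Matrix.inv_eq_right_inv`); the n-th
term has letters `(R₁, ρ−3μ, B_G(θmC)ⁿ)` (`rawEntryLetters_pow`, `_mul`), the entrywise geometric resummation gives `B_G(1−θmC)⁻¹ ≤ 2B_G`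
(`HasSum.norm_le_of_bounded`); holomorphy by Cramer (`differentiableOn_inv_apply`, `det A(u)` a unit from the right inverse).
[cite: Balaban1985BackgroundPropagators, (3.60)-(3.65) p.402, (3.86) p.407, Thm 3.4 p.400, Thm 3.10 (3.107)-(3.108) p.416, (3.26)-(3.27) p.395;
Balaban1984PropagatorsII, (2.52)-(2.55) p.232, Lemma 2.1 (2.61) p.234; Balaban1988RG2Cluster, p.13, p.15; Balaban1987RG1, (1.13)-(1.14) p.262] -/
theorem rawEntryLetters_inv_of_neumann (hA : RawEntryLetters A loc R ρ B) (h0 : A 0 * G₀ = 1)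
    (hG : ∀ i j, ‖G₀ i j‖ ≤ BG * Real.exp (-(ρ * tdist1 Nf (loc i) (loc j)))) (hBG : 0 ≤ BG)
    (hfib : ∀ y : UT Nf, (univ.filter fun k => loc k = y).card ≤ m)
    (hμ : 0 ≤ μ) (h3μ : 3 * μ ≤ ρ) (hC : 0 ≤ C)
    (hrow : ∀ a : UT Nf, ∑ z : UT Nf, Real.exp (-(μ * tdist1 Nf a z)) ≤ C)
    (hR₁ : 0 < R₁) (hR₁R : R₁ ≤ R)
    (hq : 2 * B * R₁ / R * BG * (m * C) * (m * C) ≤ 1 / 2) :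
    RawEntryLetters (fun u => (A u)⁻¹) loc R₁ (ρ - 3 * μ) (2 * BG) := by
  -- the letters of the pieces: deviation `V(u) = A(0) − A(u)`, the centre's inverse `G₀`, `K(u) = V(u)G₀`, its powers, `G₀·K(u)ⁿ⁺¹`
  have hV : RawEntryLetters (fun u => A 0 - A u) loc R₁ ρ (2 * B * R₁ / R) := rawEntryLetters_zero_sub hA hR₁.le hR₁R
  have hG0 : RawEntryLetters (fun _ : E => G₀) loc R₁ ρ BG := rawEntryLetters_const loc R₁ hBG hG
  have hK : RawEntryLetters (fun u => (A 0 - A u) * G₀) loc R₁ (ρ - μ) (2 * B * R₁ / R * BG * (m * C)) :=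
    rawEntryLetters_mul hV hG0 (κ := ρ - μ) (μ := μ) (by linarith) (by linarith) (by linarith) hC hfib hrow
  have hKpow : ∀ n : ℕ, RawEntryLetters (fun u => ((A 0 - A u) * G₀) ^ (n + 1)) loc R₁ (ρ - μ - μ)
      ((2 * B * R₁ / R * BG * (m * C)) ^ (n + 1) * (m * C) ^ n) :=
    fun n => rawEntryLetters_pow hK hμ (by linarith) hC hfib hrow n
  have hGK : ∀ n : ℕ, RawEntryLetters (fun u => G₀ * ((A 0 - A u) * G₀) ^ (n + 1)) loc R₁ (ρ - 3 * μ)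
      (BG * ((2 * B * R₁ / R * BG * (m * C)) ^ (n + 1) * (m * C) ^ n) * (m * C)) :=
    fun n => rawEntryLetters_mul hG0 (hKpow n) (κ := ρ - 3 * μ) (μ := μ) (by linarith) (by linarith) (by linarith) hC hfib hrow
  -- abbreviations for the two small numbers
  have hθ0 : 0 ≤ 2 * B * R₁ / R * BG * (m * C) := hK.B_nonneg
  have hmC : 0 ≤ (m : ℝ) * C := mul_nonneg (Nat.cast_nonneg _) hC
  have hq0 : 0 ≤ 2 * B * R₁ / R * BG * (m * C) * (m * C) := mul_nonneg hθ0 hmC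
  have hq1 : 2 * B * R₁ / R * BG * (m * C) * (m * C) < 1 := hq.trans_lt (by norm_num)
  -- print's «the norm of this operator is small»: the sup-of-row-sums norm of `V(u)G₀` is at most `½` on the thin ball
  have hnorm : ∀ u ∈ ball (0 : E) R₁, ‖(A 0 - A u) * G₀‖ ≤ 1 / 2 := by
    intro u hu
    refine linfty_opNorm_le_of_rowSum _ (by norm_num) fun i => ?_
    calc ∑ j, ‖((A 0 - A u) * G₀) i j‖
        ≤ ∑ j, 2 * B * R₁ / R * BG * (m * C) * Real.exp (-((ρ - μ) * tdist1 Nf (loc i) (loc j))) :=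
          sum_le_sum fun j _ => hK.decay u hu i j
      _ ≤ ∑ j, 2 * B * R₁ / R * BG * (m * C) * Real.exp (-(μ * tdist1 Nf (loc i) (loc j))) := by
          refine sum_le_sum fun j _ => mul_le_mul_of_nonneg_left (Real.exp_le_exp.2 ?_) hθ0
          exact neg_le_neg (mul_le_mul_of_nonneg_right (by linarith) (tdist1_nonneg _ _))
      _ ≤ 2 * B * R₁ / R * BG * (m * C) * (m * C) := rowSum_decay_le hθ0 hfib hrow i
      _ ≤ 1 / 2 := hq
  have hlt : ∀ u ∈ ball (0 : E) R₁, ‖(A 0 - A u) * G₀‖ < 1 := fun u hu => (hnorm u hu).trans_lt (by norm_num)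
  -- (3.86): `A(u)·(G₀ Σₙ (V(u)G₀)ⁿ) = 1`, so `A(u)⁻¹` IS the series
  have hright : ∀ u ∈ ball (0 : E) R₁, A u * gNew G₀ (A 0 - A u) = 1 := by
    intro u hu
    have h := sub_mul_gNew (A 0) (A 0 - A u) G₀ h0 (hlt u hu)
    rwa [sub_sub_cancel] at h
  have hinv : ∀ u ∈ ball (0 : E) R₁, (A u)⁻¹ = gNew G₀ (A 0 - A u) := fun u hu => Matrix.inv_eq_right_inv (hright u hu)
  refine ⟨fun u hu i j => ?_, fun i j => ?_, by positivity⟩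
  · -- the entrywise geometric resummation
    have hs := hasSum_apply_of_hasSum (hasSum_gNew G₀ (A 0 - A u) (hlt u hu)) i j
    have hterm : ∀ n : ℕ, ‖(G₀ * ((A 0 - A u) * G₀) ^ n) i j‖ ≤
        BG * (2 * B * R₁ / R * BG * (m * C) * (m * C)) ^ n * Real.exp (-((ρ - 3 * μ) * tdist1 Nf (loc i) (loc j))) := by
      intro n
      cases n with
      | zero =>
          rw [pow_zero, Matrix.mul_one, pow_zero, mul_one]
          refine (hG i j).trans (mul_le_mul_of_nonneg_left (Real.exp_le_exp.2 ?_) hBG)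
          exact neg_le_neg (mul_le_mul_of_nonneg_right (by linarith) (tdist1_nonneg _ _))
      | succ n =>
          refine ((hGK n).decay u hu i j).trans (le_of_eq ?_)
          rw [mul_pow]
          ring
    have hgeo : HasSum (fun n : ℕ => BG * (2 * B * R₁ / R * BG * (m * C) * (m * C)) ^ n *
        Real.exp (-((ρ - 3 * μ) * tdist1 Nf (loc i) (loc j))))
        (BG * (1 - 2 * B * R₁ / R * BG * (m * C) * (m * C))⁻¹ * Real.exp (-((ρ - 3 * μ) * tdist1 Nf (loc i) (loc j)))) :=
      ((hasSum_geometric_of_lt_one hq0 hq1).mul_left BG).mul_right _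
    have hbound := HasSum.norm_le_of_bounded hs hgeo hterm
    rw [hinv u hu]
    refine hbound.trans (mul_le_mul_of_nonneg_right ?_ (Real.exp_nonneg _))
    have hinv2 : (1 - 2 * B * R₁ / R * BG * (m * C) * (m * C))⁻¹ ≤ 2 := by
      rw [inv_le_comm₀ (by linarith) (by norm_num)]
      linarith
    calc BG * (1 - 2 * B * R₁ / R * BG * (m * C) * (m * C))⁻¹ ≤ BG * 2 := mul_le_mul_of_nonneg_left hinv2 hBG
      _ = 2 * BG := by ring
  · -- holomorphy by Cramer: `det A(u)` is a unit on the thin ball (right inverse)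
    exact differentiableOn_inv_apply (fun i j => (hA.holo i j).mono (ball_subset_ball hR₁R))
      (fun u hu => Matrix.isUnit_det_of_right_inverse (hright u hu)) i j

/-- **The same with the torus row sum DISCHARGED for every torus size** (`rowSum_torus`: `C = c₀(1,μ)^ν`, `μ > 0`).
[cite: Balaban1984PropagatorsII, Lemma 2.1 (2.61) p.234; Balaban1985BackgroundPropagators, (3.62)-(3.64) p.402, (3.86) p.407, Thm 3.10 (3.108) p.416] -/
theorem rawEntryLetters_inv_of_neumann_torus (hA : RawEntryLetters A loc R ρ B) (h0 : A 0 * G₀ = 1)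
    (hG : ∀ i j, ‖G₀ i j‖ ≤ BG * Real.exp (-(ρ * tdist1 Nf (loc i) (loc j)))) (hBG : 0 ≤ BG)
    (hfib : ∀ y : UT Nf, (univ.filter fun k => loc k = y).card ≤ m)
    (hμ : 0 < μ) (h3μ : 3 * μ ≤ ρ) (hR₁ : 0 < R₁) (hR₁R : R₁ ≤ R)
    (hq : 2 * B * R₁ / R * BG * (m * B6.c0 1 μ ^ ν) * (m * B6.c0 1 μ ^ ν) ≤ 1 / 2) :
    RawEntryLetters (fun u => (A u)⁻¹) loc R₁ (ρ - 3 * μ) (2 * BG) :=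
  rawEntryLetters_inv_of_neumann hA h0 hG hBG hfib hμ.le h3μ (pow_nonneg (B6RandomWalk.c0_nonneg 1 μ) ν)
    (fun a => rowSum_torus Nf hμ a) hR₁ hR₁R hq

end Neumann

/-! ## §4. NON-VACUITY (A2 ∕ A6): module 38's toy family inhabits every §3 binder jointly, with genuine `u`-dependence -/

section Toy

omit [Fintype p] in
/-- The toy family `u ↦ (γ+u)·1` has letters `(R, ρ, γ + R)` at EVERY rate (diagonal entries `γ + u`, off-diagonal `0`), `γ ≥ 0`, `R ≥ 0`.
[folklore] [cite: Balaban1988RG2Cluster, (2.7) p.13 (toy model, not the paper's operator)] -/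
theorem rawEntryLetters_toyFamily {γ R : ℝ} (hγ : 0 ≤ γ) (hR : 0 ≤ R) (loc : p → UT Nf) (ρ : ℝ) :
    RawEntryLetters (toyFamily (p := p) γ) loc R ρ (γ + R) where
  decay u hu i j := by
    have hu' : ‖u‖ < R := mem_ball_zero_iff.1 hu
    have hsc : ‖(γ : ℂ) + u‖ ≤ γ + R := by
      calc ‖(γ : ℂ) + u‖ ≤ ‖(γ : ℂ)‖ + ‖u‖ := norm_add_le _ _
        _ ≤ γ + R := by rw [Complex.norm_real, Real.norm_eq_abs, abs_of_nonneg hγ]; linarith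
    by_cases hij : i = j
    · subst hij
      simp only [toyFamily, Matrix.smul_apply, Matrix.one_apply_eq, smul_eq_mul, mul_one, tdist1_self, mul_zero, neg_zero,
        Real.exp_zero]
      exact hsc
    · simp only [toyFamily, Matrix.smul_apply, Matrix.one_apply_ne hij, smul_zero, norm_zero]
      exact mul_nonneg (hγ.trans (le_add_of_nonneg_right hR)) (Real.exp_nonneg _)
  holo i j := toy_holo γ _ i j
  B_nonneg := add_nonneg hγ hR

/-- At the centre the toy family is `γ·1`, with right inverse `G₀ = γ⁻¹·1` (`γ ≠ 0`). [folklore] [cite: Balaban1988RG2Cluster, (2.7) p.13 (toy model)] -/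
theorem toy_rightInverse {γ : ℝ} (hγ : γ ≠ 0) :
    toyFamily (p := p) γ 0 * (((γ : ℂ)⁻¹) • (1 : Matrix p p ℂ)) = 1 := by
  have hγ' : (γ : ℂ) ≠ 0 := Complex.ofReal_ne_zero.2 hγ
  rw [toyFamily, add_zero, Matrix.smul_mul, Matrix.one_mul, smul_smul, mul_inv_cancel₀ hγ', one_smul]

omit [Fintype p] in
/-- The centre's inverse `γ⁻¹·1` has (3.108)-letters with constant `γ⁻¹` at every rate (`γ > 0`). [folklore]
[cite: Balaban1988RG2Cluster, (2.7) p.13 (toy model); Balaban1985BackgroundPropagators, (3.108) p.416] -/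
theorem toy_G₀_letters {γ : ℝ} (hγ : 0 < γ) (loc : p → UT Nf) (ρ : ℝ) (i j : p) :
    ‖(((γ : ℂ)⁻¹) • (1 : Matrix p p ℂ)) i j‖ ≤ γ⁻¹ * Real.exp (-(ρ * tdist1 Nf (loc i) (loc j))) := by
  by_cases hij : i = j
  · subst hij
    rw [Matrix.smul_apply, Matrix.one_apply_eq, smul_eq_mul, mul_one, norm_inv, Complex.norm_real, Real.norm_eq_abs,
      abs_of_pos hγ, tdist1_self, mul_zero, neg_zero, Real.exp_zero, mul_one]
  · rw [Matrix.smul_apply, Matrix.one_apply_ne hij, smul_zero, norm_zero]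
    exact mul_nonneg (inv_nonneg.2 hγ.le) (Real.exp_nonneg _)

/-- ★ **§3 FIRES ON A `u`-DEPENDENT FAMILY** (A2 ∕ A6 witness of `rawEntryLetters_inv_of_neumann_torus`): for the toy family `(γ+u)·1` on the chart
`E = ℂ`, `γ > 0`, any location map (fibre bound `|p|`), any `μ > 0`: with `R = γ` (letters `(γ, 4μ, 2γ)`), `G₀ = γ⁻¹·1` (letters `γ⁻¹`), the thin radius
`R₁ = γ∕(8((|p|·c₀(1,μ)^ν)² + 1))` the smallness holds and the inverse family has letters `(R₁, μ, 2γ⁻¹)` — no real structure, no accretivity supplied.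
[folklore] [cite: Balaban1988RG2Cluster, (2.7) p.13 (toy model); Balaban1985BackgroundPropagators, (3.86) p.407] -/
theorem rawEntryLetters_inv_of_neumann_toy {γ μ : ℝ} (hγ : 0 < γ) (hμ : 0 < μ) (loc : p → UT Nf) :
    RawEntryLetters (fun u => (toyFamily (p := p) γ u)⁻¹) loc
      (γ / (8 * (((Fintype.card p : ℝ) * B6.c0 1 μ ^ ν) ^ 2 + 1))) (4 * μ - 3 * μ) (2 * γ⁻¹) := by
  set S : ℝ := (Fintype.card p : ℝ) * B6.c0 1 μ ^ ν with hS
  have hS0 : 0 ≤ S := mul_nonneg (Nat.cast_nonneg _) (pow_nonneg (B6RandomWalk.c0_nonneg 1 μ) ν)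
  have hden : 0 < 8 * (S ^ 2 + 1) := by positivity
  have hR₁ : 0 < γ / (8 * (S ^ 2 + 1)) := div_pos hγ hden
  have hR₁R : γ / (8 * (S ^ 2 + 1)) ≤ γ := by
    rw [div_le_iff₀ hden]
    nlinarith [sq_nonneg S]
  have hfib : ∀ y : UT Nf, (univ.filter fun k => loc k = y).card ≤ Fintype.card p :=
    fun y => (card_le_univ _)
  refine rawEntryLetters_inv_of_neumann_torus (R := γ) (ρ := 4 * μ) (B := γ + γ) (BG := γ⁻¹) (m := Fintype.card p)
    (rawEntryLetters_toyFamily hγ.le hγ.le loc (4 * μ)) (toy_rightInverse hγ.ne') (toy_G₀_letters hγ loc (4 * μ))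
    (inv_nonneg.2 hγ.le) hfib hμ (by linarith) hR₁ hR₁R ?_
  -- the smallness: `2(2γ)R₁∕γ · γ⁻¹ · S · S = S²∕(2(S²+1)) ≤ ½`
  have e : 2 * (γ + γ) * (γ / (8 * (S ^ 2 + 1))) / γ * γ⁻¹ * S * S = S ^ 2 / (2 * (S ^ 2 + 1)) := by
    field_simp
    ring
  rw [← hS, e, div_le_div_iff₀ (by positivity) (by norm_num)]
  nlinarith [sq_nonneg S]

end Toy

end Literature.MathematicalPhysics.QuantumFieldTheory.Balaban1983to89.B13InverseLettersNeumann

end
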